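import Summits.NavierStokesRegularity.NavierStokesRegularity.Theorems.PerpetualPumpAveragedTypeIBlowupHittingTime
import Summits.NavierStokesRegularity.NavierStokesRegularity.Theorems.PerpetualPumpAveragedTypeIBlowupSupContinuity

/-!
# Crux `PerpetualPump.AveragedTypeIBlowup` (stmt-NavierStokesRegularity-1835), line `Sketch`:
# stub `peakContinuity` — the renormalised peak up to a strict first crossing is continuous

This file proves the registered stub `stub_peakContinuity` of the line skeleton
`Cruxes/AveragedTypeIBlowup/Lines/Sketch.lean` (Mathlib-only). In the nested-interval shooting
argument over the datum amplitude `A`, the renormalised amplitude of step `k` is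
`β_k(A) := sup {g(A, t) : 0 ≤ t ≤ τ(A)}`, where `g(A, ·)` is the `k`-th carrier and
`τ(A) := inf {t ≥ 0 : h(A, t) ≥ 1}` is the first time the next carrier `h(A, ·)` reaches the
level `1`. The stub: if `g` and `h` are jointly continuous on `[A₀ - δ, A₀ + δ] × [0, T + δ]` and
`h(A₀, ·)` crosses the level `1` for the first time at `T > 0` STRICTLY (below `1` on `[0, T)`,
equal to `1` at `T`, above `1` on `(T, T + δ]`), then `β_k` is continuous at `A₀`.

Proof: a direct composition of the two accepted generic theorems of this line.
* `peakContinuity_sInf_eq` — a first hitting time is the infimum: if `a ≤ T'`, `c ≤ F T'` and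
  `F < c` on `[a, T')`, then `sInf {t | a ≤ t ∧ c ≤ F t} = T'` (`T'` is the least element).
* `stub_hittingTime` (file `…HittingTime`) with `F := h`, `a := 0`, `c := 1`: every parameter `A`
  near `A₀` has a first hitting time `T'(A) ∈ (0, T + δ]` of the level `1`, as close to `T` as
  desired; by the previous item `τ(A) = T'(A)`, so `τ A₀ = T`, `|τ A - T| < e` and `0 ≤ τ A` near
  `A₀`.
* `stub_supContinuity` (file `…SupContinuity`) with `a := 0` and this `τ` gives the claim.

## References

* T. Tao, *Finite time blowup for an averaged three-dimensional Navier–Stokes equation*, J. Amer.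
  Math. Soc. 29 (2016), 601–674, §5 (context only; the lemma itself is folklore real analysis).
-/

noncomputable section

-- the summit namespace `…NavierStokesRegularity.NavierStokesRegularity…` is the tree convention
set_option linter.dupNamespace false

open Set Filter Topology

namespace Summit.NavierStokesRegularity.NavierStokesRegularity.Theorems.PerpetualPumpAveragedTypeIBlowup

/-- **A first hitting time is the infimum of the super-level times.** If `a ≤ T'`, `c ≤ F T'` and
`F t < c` for all `t ∈ [a, T')`, then `T'` is the least element of `{t | a ≤ t ∧ c ≤ F t}`, hence
`sInf {t | a ≤ t ∧ c ≤ F t} = T'`. [folklore] -/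
theorem peakContinuity_sInf_eq {F : ℝ → ℝ} {a c T' : ℝ} (haT : a ≤ T') (hc : c ≤ F T')
    (hlt : ∀ t ∈ Ico a T', F t < c) : sInf {t : ℝ | a ≤ t ∧ c ≤ F t} = T' := by
  refine IsLeast.csInf_eq ⟨⟨haT, hc⟩, fun t ht => ?_⟩
  by_contra h
  exact (hlt t ⟨ht.1, not_le.1 h⟩).not_ge ht.2

/-- **Stub `peakContinuity`** (Mathlib-only). THE RENORMALISED AMPLITUDE IS CONTINUOUS IN THE
PARAMETER: if the carrier `g(A,t)` and the next carrier `h(A,t)` are jointly continuous near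
`{A₀} × [0, T+δ]`, and at `A₀` the next carrier crosses the level `1` for the first time at `T`
strictly (below `1` on `[0,T)`, equal at `T`, above right after), then
`A ↦ sup {g(A,t) : 0 ≤ t ≤ τ(A)}`, `τ(A) = inf {t ≥ 0 : h(A,t) ≥ 1}` the first hitting time, is
continuous at `A₀` (`stub_hittingTime` + `stub_supContinuity`). [folklore] -/
theorem stub_peakContinuity :
    ∀ (g h : ℝ → ℝ → ℝ) (A₀ T δ : ℝ), 0 < T → 0 < δ →
      ContinuousOn (Function.uncurry g) (Icc (A₀ - δ) (A₀ + δ) ×ˢ Icc 0 (T + δ)) →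
      ContinuousOn (Function.uncurry h) (Icc (A₀ - δ) (A₀ + δ) ×ˢ Icc 0 (T + δ)) →
      (∀ t ∈ Ico 0 T, h A₀ t < 1) → h A₀ T = 1 → (∀ t ∈ Ioc T (T + δ), 1 < h A₀ t) →
      ContinuousAt (fun A => sSup ((g A) '' Icc 0 (sInf {t : ℝ | 0 ≤ t ∧ 1 ≤ h A t}))) A₀ := by
  intro g h A₀ T δ hT hδ hg hh hlt hT1 hgt
  -- the first hitting time at the reference parameter is `T`
  have hτ₀ : sInf {t : ℝ | 0 ≤ t ∧ 1 ≤ h A₀ t} = T :=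
    peakContinuity_sInf_eq hT.le hT1.ge hlt
  -- nearby parameters: the infimum is the first hitting time produced by `stub_hittingTime`
  have hτ : ∀ e : ℝ, 0 < e → ∃ d : ℝ, 0 < d ∧ ∀ A : ℝ, |A - A₀| < d →
      |sInf {t : ℝ | 0 ≤ t ∧ 1 ≤ h A t} - T| < e ∧ 0 ≤ sInf {t : ℝ | 0 ≤ t ∧ 1 ≤ h A t} := by
    intro e he
    obtain ⟨d, hd, hdA⟩ := stub_hittingTime h A₀ 0 T δ 1 hT hδ hh hlt hT1 hgt e he
    refine ⟨d, hd, fun A hA => ?_⟩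
    obtain ⟨T', hT'T, hT'I, hhT', hbefore⟩ := hdA A hA
    rw [peakContinuity_sInf_eq hT'I.1.le hhT'.ge hbefore]
    exact ⟨hT'T, hT'I.1.le⟩
  exact stub_supContinuity g (fun A => sInf {t : ℝ | 0 ≤ t ∧ 1 ≤ h A t}) A₀ 0 T δ hT.le hδ hg
    hτ₀ hτ

end Summit.NavierStokesRegularity.NavierStokesRegularity.Theorems.PerpetualPumpAveragedTypeIBlowup

end
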